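import Summits.ValiantsHypothesis.ValiantsHypothesis.Theorems.DefinabilityGapPivotHall
import HarnessLib

/-!
# DefinabilityGap — pivot certificates: LIVENESS from half-degree load conditions

Route `route-ValiantsHypothesis-DefinabilityGap`, residual crux `KIPlantedHitting` (item 23547),
rung `R_K1.1`, ROAD P (`DefinabilityGapPivotCertificate`).  A pivot certificate `(s₀, r)` needs
(i) distinct pivot cells — a THEOREM for `m ≥ 66` (`DefinabilityGapPivotHall`, with slack
`DefinabilityGapPivotHallSlack`) — and (ii) LIVENESS: every pivot position `(r c, s₀)` lies on a
transversal of the block `S_c` avoiding the gadget zeros `W = pivotZeros m T s₀ r`.  This file is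
the deterministic kernel of (ii): the `(m−1) × (m−1)` minor of `S_c` (row `r c` and column `s₀`
deleted) has a `W`-avoiding perfect matching as soon as every row of the minor has `< m/2` killed
cells and every column `≥ (m−1)/2` free cells (`liveAt_of_halfDegree`, Hall's theorem with the
Dirac-type degree argument); the pivot cell itself is never a gadget zero
(`pivot_not_mem_pivotZeros`).  Hence `KIPivotCertificate` follows from (i) plus LOAD CONDITIONS
on the row assignment `r` (`kiPivotCertificate_of_halfDegree`), and the killed cells of `c` in
row `i ≠ r c` are controlled by the curves `c' ≠ c` with pivot row `i` meeting `c` in that row,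
two cells each at most (`card_deadCols_le`).  What remains for ROAD P (NODE-v7 §F, N1) is a row
assignment meeting these loads together with (i).
-/

noncomputable section

open Finset
open Literature.Computability.AlgebraicComplexity Literature.Computability.MetaComplexity
open Summit.ValiantsHypothesis.ValiantsHypothesis.Theorems.DefinabilityGapAffineRung
open Summit.ValiantsHypothesis.ValiantsHypothesis.Theorems.DefinabilityGapSupportRung
open Summit.ValiantsHypothesis.ValiantsHypothesis.Theorems.DefinabilityGapPivotCertificate

namespace Summit.ValiantsHypothesis.ValiantsHypothesis.Theorems.DefinabilityGapPivotLive

variable {m : ℕ}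

/-! ## 1. The minor of a block and its loads -/

/-- Free rows of column `j` in the minor of `S_c` (row `r` deleted): rows `i ≠ r` whose cell
`(i, j)` is not a zero. [this file] -/
def okRows (W : Finset (Fin (qOf m) × Fin (qOf m))) (c : Fin 3 → Fin (qOf m)) (r j : Fin m) :
    Finset (Fin m) := by
  classical exact Finset.univ.filter fun i => i ≠ r ∧ cellEmb m c (i, j) ∉ W

/-- Killed cells of row `i` in the minor of `S_c` (column `s₀` deleted). [this file] -/
def deadCols (W : Finset (Fin (qOf m) × Fin (qOf m))) (c : Fin 3 → Fin (qOf m)) (s₀ i : Fin m) :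
    Finset (Fin m) := by
  classical exact Finset.univ.filter fun j => j ≠ s₀ ∧ cellEmb m c (i, j) ∈ W

/-- Membership in the free rows of a column of the minor. [this file] -/
theorem mem_okRows {W : Finset (Fin (qOf m) × Fin (qOf m))} {c : Fin 3 → Fin (qOf m)}
    {r j i : Fin m} : i ∈ okRows W c r j ↔ i ≠ r ∧ cellEmb m c (i, j) ∉ W := by
  classical
  simp [okRows]

/-- Membership in the killed cells of a row of the minor. [this file] -/
theorem mem_deadCols {W : Finset (Fin (qOf m) × Fin (qOf m))} {c : Fin 3 → Fin (qOf m)}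
    {s₀ i j : Fin m} : j ∈ deadCols W c s₀ i ↔ j ≠ s₀ ∧ cellEmb m c (i, j) ∈ W := by
  classical
  simp [deadCols]

/-! ## 2. Liveness from half-degree conditions -/

/-- **Liveness by half degrees.** If the pivot cell `(r, s₀)` of `S_c` is not a zero, every
column `j ≠ s₀` has at least `(m−1)/2` free rows `≠ r`, and every row `i ≠ r` has fewer than
`m/2` killed cells off column `s₀`, then position `(r, s₀)` is live: a zero-free transversal of
`S_c` passes through it (Hall's theorem on the minor; small sets are matched inside one column,
large sets reach every row). [this file] -/
theorem liveAt_of_halfDegree (W : Finset (Fin (qOf m) × Fin (qOf m))) (c : Fin 3 → Fin (qOf m))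
    (r s₀ : Fin m) (hpiv : cellEmb m c (r, s₀) ∉ W)
    (hcol : ∀ j, j ≠ s₀ → m ≤ 2 * (okRows W c r j).card + 1)
    (hrow : ∀ i, i ≠ r → 2 * (deadCols W c s₀ i).card < m) :
    LiveAt m W c (r, s₀) := by
  classical
  -- Hall's condition for the columns `j ≠ s₀` into the free rows
  have hH : ∀ S : Finset {j : Fin m // j ≠ s₀},
      S.card ≤ (S.biUnion fun j => okRows W c r j.1).card := by
    intro S
    rcases S.eq_empty_or_nonempty with rfl | ⟨j₀, hj₀⟩
    · simp
    by_cases hS : 2 * S.card + 1 ≤ m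
    · have h1 : S.card ≤ (okRows W c r j₀.1).card := by have := hcol j₀.1 j₀.2; omega
      exact h1.trans (Finset.card_le_card fun i hi => Finset.mem_biUnion.mpr ⟨j₀, hj₀, hi⟩)
    · have hall : Finset.univ.erase r ⊆ S.biUnion fun j => okRows W c r j.1 := by
        intro i hi
        have hir : i ≠ r := Finset.ne_of_mem_erase hi
        by_contra hnot
        have hsub : S.map (Function.Embedding.subtype _) ⊆ deadCols W c s₀ i := by
          intro j hj
          obtain ⟨j', hj'S, rfl⟩ := Finset.mem_map.mp hj
          refine mem_deadCols.mpr ⟨j'.2, ?_⟩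
          by_contra hW
          exact hnot (Finset.mem_biUnion.mpr ⟨j', hj'S, mem_okRows.mpr ⟨hir, hW⟩⟩)
        have h1 := Finset.card_le_card hsub
        rw [Finset.card_map] at h1
        have h2 := hrow i hir
        omega
      refine le_trans ?_ (Finset.card_le_card hall)
      have hS' : (S.map (Function.Embedding.subtype _)).card ≤ (Finset.univ.erase s₀).card :=
        Finset.card_le_card fun j hj => by
          obtain ⟨j', _, rfl⟩ := Finset.mem_map.mp hj
          exact Finset.mem_erase.mpr ⟨j'.2, Finset.mem_univ _⟩
      rw [Finset.card_map] at hS'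
      rw [Finset.card_erase_of_mem (Finset.mem_univ _), Finset.card_univ, Fintype.card_fin]
        at hS' ⊢
      exact hS'
  obtain ⟨g, hg, hgt⟩ := (Finset.all_card_le_biUnion_card_iff_exists_injective _).mp hH
  -- the transversal: column `s₀ ↦ r`, column `j ≠ s₀ ↦ g j`
  let G : Fin m → Fin m := fun j => if h : j = s₀ then r else g ⟨j, h⟩
  have hGne : ∀ j (h : j ≠ s₀), G j ≠ r := by
    intro j h
    simp only [G, dif_neg h]
    exact (mem_okRows.mp (hgt ⟨j, h⟩)).1
  have hGinj : Function.Injective G := by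
    intro j j' h
    by_cases hj : j = s₀ <;> by_cases hj' : j' = s₀
    · rw [hj, hj']
    · exact absurd (by simpa [G, hj] using h.symm) (hGne j' hj')
    · exact absurd (by simpa [G, hj'] using h) (hGne j hj)
    · have h' : g ⟨j, hj⟩ = g ⟨j', hj'⟩ := by simpa [G, hj, hj'] using h
      exact congrArg Subtype.val (hg h')
  refine ⟨Equiv.ofBijective G (Finite.injective_iff_bijective.mp hGinj), fun j => ?_, ?_⟩
  · rw [Equiv.ofBijective_apply]
    by_cases hj : j = s₀
    · subst hj
      simpa [G] using hpiv
    · simp only [G, dif_neg hj]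
      exact (mem_okRows.mp (hgt ⟨j, hj⟩)).2
  · rw [Equiv.ofBijective_apply]
    simp [G]

/-! ## 3. The gadget zeros: the pivot is free, and row loads come from neighbours -/

/-- The pivot cell of `c` is never a gadget zero (gadget zeros sit off column `s₀`).
[this file] -/
theorem pivot_not_mem_pivotZeros (T : Finset (Fin 3 → Fin (qOf m))) (s₀ : Fin m)
    (r : (Fin 3 → Fin (qOf m)) → Fin m) (c : Fin 3 → Fin (qOf m)) :
    cellEmb m c (r c, s₀) ∉ pivotZeros m T s₀ r := by
  classical
  intro h
  simp only [pivotZeros, Finset.mem_biUnion, Finset.mem_image, Finset.mem_filter,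
    Finset.mem_univ, true_and] at h
  obtain ⟨c', _, s, hs, he⟩ := h
  have hp := pos_eq_of_cellEmb_eq m he
  exact hs (congrArg Prod.snd hp)

/-- A killed cell `(i, j)` of `c`, `i ≠ r c`, is the row-`i` gadget cell of a curve `c' ≠ c` with
pivot row `i` passing through it. [this file] -/
theorem exists_of_mem_pivotZeros {T : Finset (Fin 3 → Fin (qOf m))} {s₀ : Fin m}
    {r : (Fin 3 → Fin (qOf m)) → Fin m} {c : Fin 3 → Fin (qOf m)} {i j : Fin m} (hi : i ≠ r c)
    (h : cellEmb m c (i, j) ∈ pivotZeros m T s₀ r) :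
    ∃ c' ∈ T, c' ≠ c ∧ r c' = i ∧ cellEmb m c' (i, j) = cellEmb m c (i, j) := by
  classical
  simp only [pivotZeros, Finset.mem_biUnion, Finset.mem_image, Finset.mem_filter,
    Finset.mem_univ, true_and] at h
  obtain ⟨c', hc', s, _, he⟩ := h
  have hp := pos_eq_of_cellEmb_eq m he
  have h1 : r c' = i := congrArg Prod.fst hp
  have h2 : s = j := congrArg Prod.snd hp
  refine ⟨c', hc', ?_, h1, ?_⟩
  · rintro rfl
    exact hi h1.symm
  · rw [← he, h1, h2]

/-- The curves of `T` other than `c` with pivot row `i` that meet `c` in row `i`. [this file] -/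
def rowKillers (T : Finset (Fin 3 → Fin (qOf m))) (r : (Fin 3 → Fin (qOf m)) → Fin m)
    (c : Fin 3 → Fin (qOf m)) (i : Fin m) : Finset (Fin 3 → Fin (qOf m)) := by
  classical exact
    T.filter fun c' => c' ≠ c ∧ r c' = i ∧ ∃ j : Fin m, cellEmb m c' (i, j) = cellEmb m c (i, j)

/-- Two distinct blocks share at most two cells in any row (they share at most two cells).
[this file] -/
theorem card_filter_cellEmb_eq_le {c c' : Fin 3 → Fin (qOf m)} (hcc' : c' ≠ c) (i : Fin m) :
    ((Finset.univ : Finset (Fin m)).filter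
      fun j => cellEmb m c' (i, j) = cellEmb m c (i, j)).card ≤ 2 := by
  classical
  have hD := subDesign_isNWDesign m hcc'
  refine le_trans ?_ hD
  rw [← Finset.card_image_of_injective _ (f := fun j : Fin m => cellEmb m c (i, j)) ?_]
  · refine Finset.card_le_card fun x hx => ?_
    obtain ⟨j, hj, rfl⟩ := Finset.mem_image.mp hx
    have hj' := (Finset.mem_filter.mp hj).2
    refine Finset.mem_inter.mpr ⟨?_, ?_⟩
    · exact Finset.mem_map.mpr ⟨(i, j), Finset.mem_univ _, hj'⟩
    · exact Finset.mem_map.mpr ⟨(i, j), Finset.mem_univ _, rfl⟩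
  · intro j j' h
    exact congrArg Prod.snd (pos_eq_of_cellEmb_eq m h)

/-- **Row loads come from neighbours.** The killed cells of `c` in a row `i ≠ r c` number at
most twice the curves `c' ≠ c` with pivot row `i` meeting `c` in row `i`. [this file] -/
theorem card_deadCols_le (T : Finset (Fin 3 → Fin (qOf m))) (s₀ : Fin m)
    (r : (Fin 3 → Fin (qOf m)) → Fin m) (c : Fin 3 → Fin (qOf m)) {i : Fin m} (hi : i ≠ r c) :
    (deadCols (pivotZeros m T s₀ r) c s₀ i).card ≤ 2 * (rowKillers T r c i).card := by
  classical
  have hsub : deadCols (pivotZeros m T s₀ r) c s₀ i ⊆ (rowKillers T r c i).biUnion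
      fun c' => Finset.univ.filter fun j => cellEmb m c' (i, j) = cellEmb m c (i, j) := by
    intro j hj
    obtain ⟨_, hW⟩ := mem_deadCols.mp hj
    obtain ⟨c', hc'T, hne, hrow, he⟩ := exists_of_mem_pivotZeros hi hW
    refine Finset.mem_biUnion.mpr ⟨c', ?_, Finset.mem_filter.mpr ⟨Finset.mem_univ _, he⟩⟩
    simp only [rowKillers, Finset.mem_filter]
    exact ⟨hc'T, hne, hrow, j, he⟩
  refine (Finset.card_le_card hsub).trans (Finset.card_biUnion_le.trans ?_)
  have h2 := Finset.sum_le_card_nsmul (rowKillers T r c i)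
    (fun c' => ((Finset.univ : Finset (Fin m)).filter
      fun j => cellEmb m c' (i, j) = cellEmb m c (i, j)).card) 2 fun c' hc' => by
    have hne : c' ≠ c := by
      simp only [rowKillers, Finset.mem_filter] at hc'
      exact hc'.2.1
    exact card_filter_cellEmb_eq_le hne i
  rw [smul_eq_mul] at h2
  omega

/-! ## 4. The certificate from (i) and the loads -/

/-- **Pivot certificate from distinct pivots and half-degree loads.** [this file] -/
theorem kiPivotCertificate_of_halfDegree (T : Finset (Fin 3 → Fin (qOf m))) (s₀ : Fin m)
    (r : (Fin 3 → Fin (qOf m)) → Fin m)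
    (hinj : ∀ c ∈ T, ∀ c' ∈ T, cellEmb m c (r c, s₀) = cellEmb m c' (r c', s₀) → c = c')
    (hcol : ∀ c ∈ T, ∀ j, j ≠ s₀ → m ≤ 2 * (okRows (pivotZeros m T s₀ r) c (r c) j).card + 1)
    (hrow : ∀ c ∈ T, ∀ i, i ≠ r c → 2 * (deadCols (pivotZeros m T s₀ r) c s₀ i).card < m) :
    KIPivotCertificate m T s₀ r :=
  ⟨hinj, fun c hc => liveAt_of_halfDegree _ c (r c) s₀ (pivot_not_mem_pivotZeros T s₀ r c)
    (hcol c hc) (hrow c hc)⟩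

/-- **Row loads via neighbour counts**: it suffices that every curve `c` sees, in each row
`i ≠ r c`, fewer than `m/4` curves `c' ≠ c` with pivot row `i` meeting it there. [this file] -/
theorem rowLoad_of_killers (T : Finset (Fin 3 → Fin (qOf m))) (s₀ : Fin m)
    (r : (Fin 3 → Fin (qOf m)) → Fin m) (c : Fin 3 → Fin (qOf m))
    (h : ∀ i, i ≠ r c → 4 * (rowKillers T r c i).card < m) (i : Fin m) (hi : i ≠ r c) :
    2 * (deadCols (pivotZeros m T s₀ r) c s₀ i).card < m := by
  have := card_deadCols_le T s₀ r c hi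
  have := h i hi
  omega

end Summit.ValiantsHypothesis.ValiantsHypothesis.Theorems.DefinabilityGapPivotLive
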